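import Literature.Analysis.FluidPDE.LocalBiotSavart
import Literature.Analysis.FluidPDE.NewtonNearGradPotential
import Literature.Analysis.FluidPDE.NewtonKernelLogPotential
import Literature.Analysis.FluidPDE.BiotSavartNewtonKernel
import Literature.Analysis.FluidPDE.SobolevWholeSpace
import Literature.Analysis.FunctionSpaces.MorreyInequality
import HarnessLib

/-!
# The Beale–Kato–Majda logarithmic bound for the velocity gradient (Majda–Bertozzi Prop. 3.8)

Analysis/FluidPDE support file (theorems only, no definitions, no named facts) on the discharge
path of `Literature.Analysis.FluidPDE.MajdaBertozzi2002_bkmAprioriH3` (`NSVorticityBKM.lean`;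
Majda–Bertozzi, *Vorticity and Incompressible Flow*, CUP 2002, §3.3). It proves the potential
theory estimate of the proof of Thm. 3.6, Prop. 3.8 / (3.87) (held text pp. 116–117:
"`|∇v|_{L^∞} ≤ c{|ω|_{C^γ} ε^γ + max(1, ln(R₀/ε))|ω|_{L^∞}}`" for the near part,
"`|(∇v)₂|_{L^∞} ≤ C R₀^{-N/2}‖ω‖₀`" for the far part, and "Sobolev inequality (3.30) implies that
`‖ω‖_γ ≤ c‖ω‖₂`"), in the form delivered by the tree's **local** Biot–Savart law
(`LocalBiotSavart.lean`: on the unit ball about `x`,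
`∂ₖuₘ = −(∂ₖ∂ₐN[ψω_b] − ∂ₖ∂_bN[ψωₐ]) + ∂ₖΛ[ψuₘ]` with `N` the truncated Newtonian potential at
radii `(1/2, 1)` and `Λ` a smooth averaging operator), so that the far field is controlled by the
energy `‖v‖_{L²}` rather than by `‖ω‖_{L²}`:

* `fderiv_newtonNearPotential_eq_newtonNearGradPotential` — the link between the truncated
  Newtonian potential `N[g] = newtonNearPotential r₀ r₁ g` of `NewtonLocalPotential.lean` and the
  gradient potential `T⁰_a g = newtonNearGradPotential r₀ r₁ a g` of `NewtonNearGradPotential.lean`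
  (whose derivative is the singular integral on differences): `∂ₐ N[g] = T⁰_a g` for `g ∈ C¹_c`,
  i.e. the first derivative may be moved onto the `W^{1,1}` kernel `Γ₀ = Γ − Γ∞`
  (Gilbarg–Trudinger Lemma 4.1, `D(Γ ⋆ g) = (DΓ) ⋆ g`: the tree's
  `integral_newtonKernel_smul_fderiv_eq` for `Γ` and a smooth integration by parts for `Γ∞`);
  hence `fderiv_fderiv_newtonNearPotential_eq_czDiff`:
  `∂_b∂_a N[g](x) = ∫ ∂_b∂_aΓ₀(x − y)(g(y) − g(x)) dy`;
* `holderWith_locVort` — the localised vorticity `ψω_b` is `½`-Hölder with constant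
  `H + Ω√C₀` when `ω = curl v` is `½`-Hölder with constant `H` and bounded by `Ω`
  (`‖Dψ‖ ≤ C₀`, `0 ≤ ψ ≤ 1`);
* `abs_hessPot_le_log` — each Hessian entry `∂ₖ∂ₐN[ψω_b](x)` obeys the logarithmic bound of the
  tree's `IsHolderCZKernel.norm_czDiff_le_log` (`NewtonKernelLogPotential.lean`):
  `≤ A c₃ ((H + Ω√C₀) δ^{1/2}/(1/2) + 2 Ω log(1/δ))` for `0 < δ ≤ 1`;
* `exists_opNorm_fderiv_le_log` — **the estimate (3.87) in the tree's class**: there is an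
  absolute constant `C` such that for every smooth divergence-free `v` with `∫|v|² < ∞`, every
  `½`-Hölder constant `H` and sup bound `Ω` of `curl v`, every `0 < δ ≤ 1` and every `x`,
  `‖Dv(x)‖ ≤ C ( (H + Ω) δ^{1/2} + Ω log(1/δ) + (∫|v|²)^{1/2} )`;
* `exists_holderWith_curl` — the Sobolev input: the `½`-Hölder constant of `curl v` is at most
  `C_H ‖D² curl v‖_{L²}` (Morrey's inequality with `p = 6`, `FunctionSpaces.morrey_holder`, and
  the Gagliardo–Nirenberg–Sobolev inequality `‖Dω‖_{L⁶} ≤ K‖D²ω‖_{L²}`,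
  `eLpNorm_six_le_eLpNorm_fderiv_two`).

## Mathlib / tree search

Tree (all used): `opNorm_fderiv_le_hessMajorant_add`, `sum_abs_fderiv_smoothing_le_sqrt`,
`hessMajorant`, `hessPot`, `locVort`, `contDiff_locVort`, `hasCompactSupport_locVort`
(`LocalBiotSavart`); `ballCutoff`, `abs_ballCutoff_le_one`, `ballCutoff_nonneg`,
`ballCutoff_le_one`, `exists_norm_fderiv_ballCutoff_le` (`BallCutoff`); `newtonNearPotential`,
`fderiv_newtonNearPotential_apply` (`NewtonLocalPotential`); `newtonNearGradPotential`,
`fderiv_newtonNearGradPotential_apply` (`NewtonNearGradPotential`); `newtonNearGrad`,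
`fderiv_newtonNear_eq_sub` (`NewtonNearDerivatives`); `newtonNear_eq_sub`, `contDiff_newtonFar`
(`NewtonKernel`); `integral_newtonKernel_smul_fderiv_eq`, `integrable_newtonKernel_smul`,
`integrable_fderiv_newtonKernel_smul` (`BiotSavartNewtonKernel`);
`exists_isHolderCZKernel_newtonNearHess` (`NewtonNearCZ`); `IsHolderCZKernel.norm_czDiff_le_log`
(`NewtonKernelLogPotential`; `lean search 'norm_czDiff_le_log'` — the kernel-level logarithm was
already in the tree, proved for Ferrari's estimate, and is reused, not restated);
`FunctionSpaces.holderWith_of_dist_le`, `holderWith_iff_dist_le` (`HolderAlgebra`);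
`FunctionSpaces.morrey_holder` (`MorreyInequality`); `eLpNorm_six_le_eLpNorm_fderiv_two`
(`SobolevWholeSpace`); `contDiff_curl` (`VorticityCalculus`). Mathlib:
`integral_mul_fderiv_eq_neg_fderiv_mul_of_integrable`, `integral_sub_left_eq_self`,
`Convex.norm_image_sub_le_of_norm_fderiv_le`, `PiLp.norm_apply_le`, `Real.abs_le_sqrt`.

## References

* A. J. Majda, A. L. Bertozzi, *Vorticity and Incompressible Flow*, CUP 2002, §3.3, Prop. 3.8
  and its proof, (3.83), (3.85)–(3.87) (held text pp. 116–117). [MajdaBertozzi2002]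
* J. T. Beale, T. Kato, A. Majda, Comm. Math. Phys. 94 (1984), 61–66, (13)–(15).
  [BealeKatoMajda1984]
* D. Gilbarg, N. S. Trudinger, *Elliptic Partial Differential Equations of Second Order* (2001),
  Lemma 4.1, Lemma 4.2 with (4.10). [GilbargTrudinger2001]
-/

noncomputable section

open MeasureTheory Set Function Filter Metric Real
open _root_.Topology
open scoped NNReal ENNReal ContDiff

namespace Literature.Analysis.FluidPDE

open NewtonPotentialHolder

/-! ### The first derivative of the truncated potential is the gradient potential -/

section GradPotential

variable {r₀ r₁ : ℝ}

/-- **`∂ₐ N[g] = T⁰_a g` for `g ∈ C¹_c`**: the first derivative of the truncated Newtonian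
potential `N[g](x) = ∫ Γ₀(z) g(x − z) dz` is the gradient potential
`∫ ∂ₐΓ₀(x − y) g(y) dy` (Gilbarg–Trudinger, Lemma 4.1: `D(Γ ⋆ g) = (DΓ) ⋆ g`, localised:
`Γ₀ = Γ − Γ∞` with `Γ∞` smooth, the derivative is moved onto `Γ` by
`integral_newtonKernel_smul_fderiv_eq` and onto `Γ∞` by a smooth integration by parts).
[cite: GilbargTrudinger2001, Lemma 4.1] -/
theorem fderiv_newtonNearPotential_eq_newtonNearGradPotential (h₀ : 0 < r₀) (h₁ : r₀ < r₁)
    {g : (EuclideanSpace ℝ (Fin 3)) → ℝ} (hg : ContDiff ℝ 1 g) (hgc : HasCompactSupport g) (x a : (EuclideanSpace ℝ (Fin 3))) :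
    fderiv ℝ (newtonNearPotential r₀ r₁ g) x a = newtonNearGradPotential r₀ r₁ a g x := by
  have hgcont : Continuous g := hg.continuous
  have hga : Continuous fun w => fderiv ℝ g w a :=
    (hg.continuous_fderiv one_ne_zero).clm_apply continuous_const
  have hgac : HasCompactSupport fun w => fderiv ℝ g w a := hgc.fderiv_apply (𝕜 := ℝ) a
  rw [fderiv_newtonNearPotential_apply h₀.le h₁ hg x a, newtonNearPotential_apply,
    newtonNearGradPotential]
  -- change variables `z = x - y`
  have hcv : ∫ z, newtonNear r₀ r₁ z * fderiv ℝ g (x - z) a =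
      ∫ y, newtonNear r₀ r₁ (x - y) * fderiv ℝ g y a := by
    have h := integral_sub_left_eq_self
      (fun z => newtonNear r₀ r₁ z * fderiv ℝ g (x - z) a) volume x
    simp only [sub_sub_cancel] at h
    exact h.symm
  rw [hcv]
  -- `Γ₀ = Γ - Γ∞`
  have hF : ContDiff ℝ 1 (newtonFar r₀ r₁) := contDiff_newtonFar h₀ h₁
  have hFcont : Continuous (newtonFar r₀ r₁) := hF.continuous
  have hFa : Continuous fun w => fderiv ℝ (newtonFar r₀ r₁) w a :=
    (hF.continuous_fderiv one_ne_zero).clm_apply continuous_const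
  have i1 : Integrable fun y => newtonKernel (x - y) * fderiv ℝ g y a := by
    have := integrable_newtonKernel_smul hga hgac x
    simpa only [smul_eq_mul] using this
  have i2 : Integrable fun y => newtonFar r₀ r₁ (x - y) * fderiv ℝ g y a :=
    ((hFcont.comp (continuous_const.sub continuous_id)).mul hga).integrable_of_hasCompactSupport
      hgac.mul_left
  have i3 : Integrable fun y => (fderiv ℝ newtonKernel (x - y) a) * g y := by
    have := integrable_fderiv_newtonKernel_smul hgcont hgc x a
    simpa only [smul_eq_mul] using this
  have i4 : Integrable fun y => (fderiv ℝ (newtonFar r₀ r₁) (x - y) a) * g y :=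
    ((hFa.comp (continuous_const.sub continuous_id)).mul hgcont).integrable_of_hasCompactSupport
      hgc.mul_left
  have hsplit : (fun y => newtonNear r₀ r₁ (x - y) * fderiv ℝ g y a) =
      fun y => newtonKernel (x - y) * fderiv ℝ g y a - newtonFar r₀ r₁ (x - y) * fderiv ℝ g y a := by
    funext y
    rw [newtonNear_eq_sub]
    ring
  rw [hsplit, integral_sub i1 i2]
  -- move the derivative onto `Γ`
  have hΓ : ∫ y, newtonKernel (x - y) * fderiv ℝ g y a =
      ∫ y, (fderiv ℝ newtonKernel (x - y) a) * g y := by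
    have := integral_newtonKernel_smul_fderiv_eq (F := ℝ) hg hgc x a
    simpa only [smul_eq_mul] using this
  -- move the derivative onto `Γ∞` (smooth integration by parts)
  have hGfar : ∫ y, newtonFar r₀ r₁ (x - y) * fderiv ℝ g y a =
      ∫ y, (fderiv ℝ (newtonFar r₀ r₁) (x - y) a) * g y := by
    have hk : ContDiff ℝ 1 fun y : (EuclideanSpace ℝ (Fin 3)) => newtonFar r₀ r₁ (x - y) :=
      hF.comp (contDiff_const.sub contDiff_id)
    have hkd : ∀ y, fderiv ℝ (fun z : (EuclideanSpace ℝ (Fin 3)) => newtonFar r₀ r₁ (x - z)) y a =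
        -fderiv ℝ (newtonFar r₀ r₁) (x - y) a := fun y =>
      fderiv_comp_const_sub_apply hF x y a
    have j1 : Integrable fun y => (fderiv ℝ (fun z : (EuclideanSpace ℝ (Fin 3)) => newtonFar r₀ r₁ (x - z)) y a) * g y := by
      have e : (fun y => (fderiv ℝ (fun z : (EuclideanSpace ℝ (Fin 3)) => newtonFar r₀ r₁ (x - z)) y a) * g y) =
          fun y => -((fderiv ℝ (newtonFar r₀ r₁) (x - y) a) * g y) := by
        funext y; rw [hkd y]; ring
      rw [e]
      exact i4.neg
    have j3 : Integrable fun y => newtonFar r₀ r₁ (x - y) * g y :=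
      ((hFcont.comp (continuous_const.sub continuous_id)).mul hgcont).integrable_of_hasCompactSupport
        hgc.mul_left
    have hibp := integral_mul_fderiv_eq_neg_fderiv_mul_of_integrable (μ := (volume : Measure (EuclideanSpace ℝ (Fin 3))))
      (f := fun y : (EuclideanSpace ℝ (Fin 3)) => newtonFar r₀ r₁ (x - y)) (g := g) (v := a) j1 i2 j3
      (fun y _ => (hk.differentiable one_ne_zero y)) (fun y _ => hg.differentiable one_ne_zero y)
    rw [hibp]
    have e : (fun y => (fderiv ℝ (fun z : (EuclideanSpace ℝ (Fin 3)) => newtonFar r₀ r₁ (x - z)) y a) * g y) =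
        fun y => -((fderiv ℝ (newtonFar r₀ r₁) (x - y) a) * g y) := by
      funext y; rw [hkd y]; ring
    rw [e, integral_neg, neg_neg]
  rw [hΓ, hGfar, ← integral_sub i3 i4]
  -- `∂ₐΓ₀ = ∂ₐΓ - ∂ₐΓ∞` off the diagonal (a null set)
  refine integral_congr_ae ?_
  have hne : ∀ᵐ y ∂(volume : Measure (EuclideanSpace ℝ (Fin 3))), y ≠ x := by
    have : ({x} : Set (EuclideanSpace ℝ (Fin 3)))ᶜ ∈ ae (volume : Measure (EuclideanSpace ℝ (Fin 3))) :=
      compl_mem_ae_iff.2 (measure_singleton _)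
    filter_upwards [this] with y hy
    simpa using hy
  filter_upwards [hne] with y hy
  have hxy : x - y ≠ 0 := sub_ne_zero.2 (Ne.symm hy)
  rw [smul_eq_mul, newtonNearGrad_apply, fderiv_newtonNear_eq_sub h₀ h₁ hxy]
  simp only [FunLike.coe_sub, Pi.sub_apply]
  ring

/-- **The Hessian of the truncated Newtonian potential of a `C¹_c` density is the singular
integral on differences**: `∂_b∂_a N[g](x) = ∫ ∂_b∂_aΓ₀(x − y)(g(y) − g(x)) dy` whenever `g` is
in addition `γ`-Hölder for some `0 < γ < 1` (which every `C¹_c` function is; the Hölder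
hypothesis is kept explicit because the singular integral is stated for Hölder densities).
Gilbarg–Trudinger Lemma 4.2 with (4.10), boundary-free form of the tree
(`fderiv_newtonNearGradPotential_apply`). [cite: GilbargTrudinger2001, Lemma 4.2 with (4.10)] -/
theorem fderiv_fderiv_newtonNearPotential_eq_czDiff (h₀ : 0 < r₀) (h₁ : r₀ < r₁)
    {g : (EuclideanSpace ℝ (Fin 3)) → ℝ} (hg : ContDiff ℝ 1 g) (hgc : HasCompactSupport g) {Cg γ : ℝ≥0}
    (hγ : 0 < γ) (hγ1 : γ < 1) (hH : HolderWith Cg γ g) (x a b : (EuclideanSpace ℝ (Fin 3))) :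
    fderiv ℝ (fun y => fderiv ℝ (newtonNearPotential r₀ r₁ g) y a) x b =
      czDiff (newtonNearHess r₀ r₁ a b) g x := by
  have hfun : (fun y => fderiv ℝ (newtonNearPotential r₀ r₁ g) y a) =
      newtonNearGradPotential r₀ r₁ a g :=
    funext fun y => fderiv_newtonNearPotential_eq_newtonNearGradPotential h₀ h₁ hg hgc y a
  rw [hfun, fderiv_newtonNearGradPotential_apply h₀ h₁ a hH hγ hγ1 x b]

end GradPotential

/-! ### Hölder continuity of the localised vorticity -/

section Holder

variable {v : (EuclideanSpace ℝ (Fin 3)) → (EuclideanSpace ℝ (Fin 3))} {c : (EuclideanSpace ℝ (Fin 3))} {r : ℝ}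

/-- A `[0, 1]`-valued `C¹` cutoff with `‖Dψ‖ ≤ C₀` satisfies `|ψ(y) − ψ(y')| ≤ √C₀ |y − y'|^{1/2}`
(interpolating `|ψ(y) − ψ(y')| ≤ 1` and the mean value bound `≤ C₀|y − y'|`). [folklore] -/
theorem abs_ballCutoff_sub_le_sqrt {C₀ : ℝ} (hC₀ : 0 ≤ C₀)
    (hψ : ∀ y, ‖fderiv ℝ (ballCutoff c r) y‖ ≤ C₀) (y y' : (EuclideanSpace ℝ (Fin 3))) :
    |ballCutoff c r y - ballCutoff c r y'| ≤ Real.sqrt C₀ * ‖y - y'‖ ^ (1 / 2 : ℝ) := by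
  have h1 : |ballCutoff c r y - ballCutoff c r y'| ≤ 1 := by
    rw [abs_sub_le_iff]
    constructor <;>
      linarith [ballCutoff_nonneg c r y, ballCutoff_le_one c r y, ballCutoff_nonneg c r y',
        ballCutoff_le_one c r y']
  have h2 : |ballCutoff c r y - ballCutoff c r y'| ≤ C₀ * ‖y - y'‖ := by
    rw [← Real.norm_eq_abs]
    exact (convex_univ).norm_image_sub_le_of_norm_fderiv_le
      (fun z _ => ((contDiff_ballCutoff c r (n := 1)).differentiable one_ne_zero z))
      (fun z _ => hψ z) (mem_univ y') (mem_univ y)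
  have h3 : (ballCutoff c r y - ballCutoff c r y') ^ 2 ≤ C₀ * ‖y - y'‖ := by
    rw [← sq_abs, sq]
    exact (mul_le_mul h1 h2 (abs_nonneg _) zero_le_one).trans_eq (one_mul _)
  calc |ballCutoff c r y - ballCutoff c r y'| ≤ Real.sqrt (C₀ * ‖y - y'‖) :=
        Real.abs_le_sqrt h3
    _ = Real.sqrt C₀ * ‖y - y'‖ ^ (1 / 2 : ℝ) := by
        rw [Real.sqrt_mul hC₀, Real.sqrt_eq_rpow (‖y - y'‖)]

/-- **The localised vorticity `W_b = ψ ω_b` is `½`-Hölder** with constant `H + Ω√C₀` when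
`ω = curl v` is `½`-Hölder with constant `H` and bounded by `Ω`, and the cutoff `ψ ∈ [0, 1]`
has `‖Dψ‖ ≤ C₀` (`|ψω(y) − ψω(y')| ≤ |ψ(y)||ω(y) − ω(y')| + |ω(y')||ψ(y) − ψ(y')|`). [folklore] -/
theorem holderWith_locVort {H Ω : ℝ≥0} (hH : HolderWith H (1 / 2) (curl v))
    (hΩ : ∀ y, ‖curl v y‖ ≤ Ω) {C₀ : ℝ} (hC₀ : 0 ≤ C₀)
    (hψ : ∀ y, ‖fderiv ℝ (ballCutoff c r) y‖ ≤ C₀) (b : Fin 3) :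
    HolderWith (H + Ω * (Real.sqrt C₀).toNNReal) (1 / 2) (locVort v c r b) := by
  have hHd := (FunctionSpaces.holderWith_iff_dist_le).1 hH
  refine FunctionSpaces.holderWith_of_dist_le fun y y' => ?_
  have hexp : (((1 / 2 : ℝ≥0) : ℝ)) = 1 / 2 := by norm_num
  rw [hexp] at hHd ⊢
  rw [Real.dist_eq, locVort, locVort, dist_eq_norm]
  have hcoe : ((H + Ω * (Real.sqrt C₀).toNNReal : ℝ≥0) : ℝ) = H + Ω * Real.sqrt C₀ := by
    rw [NNReal.coe_add, NNReal.coe_mul, Real.coe_toNNReal _ (Real.sqrt_nonneg _)]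
  rw [hcoe]
  have hωb : |curl v y b - curl v y' b| ≤ H * ‖y - y'‖ ^ (1 / 2 : ℝ) := by
    have h1 : |curl v y b - curl v y' b| ≤ ‖curl v y - curl v y'‖ := by
      have := PiLp.norm_apply_le (curl v y - curl v y') b
      simpa [Real.norm_eq_abs] using this
    have h2 := hHd y y'
    rw [dist_eq_norm, dist_eq_norm] at h2
    exact h1.trans h2
  have hωb' : |curl v y' b| ≤ Ω := by
    have := PiLp.norm_apply_le (curl v y') b
    rw [Real.norm_eq_abs] at this
    exact this.trans (hΩ y')
  have hψ1 : |ballCutoff c r y| ≤ 1 := abs_ballCutoff_le_one c r y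
  have hψd := abs_ballCutoff_sub_le_sqrt hC₀ hψ y y'
  have hd0 : 0 ≤ ‖y - y'‖ ^ (1 / 2 : ℝ) := Real.rpow_nonneg (norm_nonneg _) _
  have key : ballCutoff c r y * curl v y b - ballCutoff c r y' * curl v y' b =
      ballCutoff c r y * (curl v y b - curl v y' b) + curl v y' b * (ballCutoff c r y - ballCutoff c r y') := by
    ring
  rw [key]
  calc |ballCutoff c r y * (curl v y b - curl v y' b) + curl v y' b * (ballCutoff c r y - ballCutoff c r y')|
      ≤ |ballCutoff c r y| * |curl v y b - curl v y' b| + |curl v y' b| * |ballCutoff c r y - ballCutoff c r y'| := by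
        refine (abs_add_le _ _).trans ?_
        rw [abs_mul, abs_mul]
    _ ≤ 1 * (H * ‖y - y'‖ ^ (1 / 2 : ℝ)) + Ω * (Real.sqrt C₀ * ‖y - y'‖ ^ (1 / 2 : ℝ)) := by
        gcongr
    _ = (H + Ω * Real.sqrt C₀) * ‖y - y'‖ ^ (1 / 2 : ℝ) := by ring

/-- The localised vorticity is bounded by the sup of the vorticity: `|W_b| ≤ Ω`. [folklore] -/
theorem norm_locVort_le {Ω : ℝ≥0} (hΩ : ∀ y, ‖curl v y‖ ≤ Ω) (b : Fin 3) (y : (EuclideanSpace ℝ (Fin 3))) :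
    ‖locVort v c r b y‖ ≤ Ω := by
  rw [locVort, norm_mul, Real.norm_eq_abs]
  have h1 : |ballCutoff c r y| ≤ 1 := abs_ballCutoff_le_one c r y
  have h2 : ‖curl v y b‖ ≤ Ω := (PiLp.norm_apply_le (curl v y) b).trans (hΩ y)
  calc |ballCutoff c r y| * ‖curl v y b‖ ≤ 1 * Ω :=
        mul_le_mul h1 h2 (norm_nonneg _) zero_le_one
    _ = Ω := one_mul _

end Holder

/-! ### The logarithmic bound for the Hessian entries of the local representation -/

section HessLog

variable {v : (EuclideanSpace ℝ (Fin 3)) → (EuclideanSpace ℝ (Fin 3))} {c : (EuclideanSpace ℝ (Fin 3))}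

/-- **Logarithmic bound for one Hessian entry** of the truncated Newtonian potential of the
localised vorticity at unit scale (`r = 1`, kernel radii `(1/2, 1)`): for `0 < δ ≤ 1`,
`|∂ₖ∂ₐN[ψω_b](x)| ≤ A (H + Ω√C₀) c₃ δ^{1/2}/(1/2) + 2 Ω A c₃ log(1/δ)`, `c₃ = 3|B₁|`, `A` the
size constant of the Hessian kernel (`exists_isHolderCZKernel_newtonNearHess`). This is (3.87)
entry by entry. [cite: MajdaBertozzi2002, §3.3 proof of Prop. 3.8, (3.87) (p. 117)] -/
theorem abs_hessPot_le_log (hv : ContDiff ℝ ∞ v) {H Ω : ℝ≥0} (hH : HolderWith H (1 / 2) (curl v))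
    (hΩ : ∀ y, ‖curl v y‖ ≤ Ω) {C₀ : ℝ} (hC₀ : 0 ≤ C₀)
    (hψ : ∀ y, ‖fderiv ℝ (ballCutoff c 1) y‖ ≤ C₀) {A B A₀ : ℝ}
    (hK : ∀ a b : (EuclideanSpace ℝ (Fin 3)), IsHolderCZKernel (newtonNearHess (1 / 2) 1 a b) 1 (A * ‖a‖ * ‖b‖)
      (B * ‖a‖ * ‖b‖) (A₀ * ‖a‖ * ‖b‖))
    {δ : ℝ} (hδ : 0 < δ) (hδ1 : δ ≤ 1) (k a b : Fin 3) (x : (EuclideanSpace ℝ (Fin 3))) :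
    |hessPot v c 1 k a b x| ≤
      A * (3 * (volume : Measure (EuclideanSpace ℝ (Fin 3))).real (ball 0 1)) *
        ((H + Ω * Real.sqrt C₀) * (δ ^ (1 / 2 : ℝ) / (1 / 2)) + 2 * Ω * Real.log (1 / δ)) := by
  have h₀ : (0 : ℝ) < 1 / 2 := by norm_num
  have h₁ : (1 / 2 : ℝ) < 1 := by norm_num
  have hγ : (0 : ℝ≥0) < 1 / 2 := by norm_num
  have hγ1 : (1 / 2 : ℝ≥0) < 1 := by
    rw [← NNReal.coe_lt_coe]; norm_num
  have hW1 : ContDiff ℝ 1 (locVort v c 1 b) := contDiff_locVort hv c 1 b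
  have hWc : HasCompactSupport (locVort v c 1 b) := hasCompactSupport_locVort one_pos v b
  have hWH := holderWith_locVort (c := c) (r := 1) hH hΩ hC₀ hψ b
  -- the Hessian entry is the singular integral on differences
  have hrep : hessPot v c 1 k a b x =
      czDiff (newtonNearHess (1 / 2) 1 (EuclideanSpace.single a (1 : ℝ))
        (EuclideanSpace.single k (1 : ℝ))) (locVort v c 1 b) x := by
    rw [hessPot, show ((1 : ℝ) / 2) = 1 / 2 from rfl]
    exact fderiv_fderiv_newtonNearPotential_eq_czDiff h₀ h₁ hW1 hWc hγ hγ1 hWH x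
      (EuclideanSpace.single a (1 : ℝ)) (EuclideanSpace.single k (1 : ℝ))
  rw [hrep, ← Real.norm_eq_abs]
  have hlog := (hK (EuclideanSpace.single a (1 : ℝ))
    (EuclideanSpace.single k (1 : ℝ))).norm_czDiff_le_log hWH hγ hγ1
    (norm_locVort_le (c := c) (r := 1) hΩ b)
    hδ hδ1 x
  have hna : ‖(EuclideanSpace.single a (1 : ℝ))‖ = 1 := by simp
  have hnk : ‖(EuclideanSpace.single k (1 : ℝ))‖ = 1 := by simp
  rw [hna, hnk, mul_one, mul_one] at hlog
  have hcoe : ((H + Ω * (Real.sqrt C₀).toNNReal : ℝ≥0) : ℝ) = H + Ω * Real.sqrt C₀ := by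
    rw [NNReal.coe_add, NNReal.coe_mul, Real.coe_toNNReal _ (Real.sqrt_nonneg _)]
  have hexp : (((1 / 2 : ℝ≥0) : ℝ)) = 1 / 2 := by norm_num
  rw [hcoe, hexp] at hlog
  exact hlog

end HessLog

/-! ### The potential theory estimate for the velocity gradient -/

section Velocity

/-- **Majda–Bertozzi Prop. 3.8 / (3.87) in the tree's class.** There is an absolute constant
`C ≥ 0` such that for every smooth divergence-free `v : ℝ³ → ℝ³` of finite energy, every
`½`-Hölder constant `H` and sup bound `Ω` of `ω = curl v`, every `0 < δ ≤ 1` and every point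
`x`,
`‖Dv(x)‖ ≤ C ( (H + Ω) δ^{1/2} + Ω log(1/δ) + (∫|v|²)^{1/2} )`.
Printed (p. 117): `|∇v|_{L^∞} ≤ c{|ω|_{C^γ} ε^γ + max(1, ln(R₀/ε))|ω|_{L^∞}} + C R₀^{-N/2}‖ω‖₀`
before the choice of `ε`; here `γ = ½`, `R₀ = 1`, the near part comes from the local Biot–Savart
law of `LocalBiotSavart.lean` (27 Hessian entries, `abs_hessPot_le_log`) and the far part is its
smoothing remainder, bounded by the energy (`sum_abs_fderiv_smoothing_le_sqrt`).
[cite: MajdaBertozzi2002, §3.3 Prop. 3.8, (3.83) and (3.87) (pp. 116–117)] -/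
theorem exists_opNorm_fderiv_le_log :
    ∃ C : ℝ, 0 ≤ C ∧ ∀ (v : (EuclideanSpace ℝ (Fin 3)) → (EuclideanSpace ℝ (Fin 3))), ContDiff ℝ ∞ v → VectorCalculus.IsDivFree v →
      Integrable (fun y => ‖v y‖ ^ 2) →
      ∀ (H Ω : ℝ≥0), HolderWith H (1 / 2) (curl v) → (∀ y, ‖curl v y‖ ≤ Ω) →
      ∀ δ : ℝ, 0 < δ → δ ≤ 1 → ∀ x : (EuclideanSpace ℝ (Fin 3)),
        ‖fderiv ℝ v x‖ ≤ C * ((H + Ω) * δ ^ (1 / 2 : ℝ) + Ω * Real.log (1 / δ) +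
          Real.sqrt (∫ y, ‖v y‖ ^ 2)) := by
  obtain ⟨A, B, A₀, hA, -, -, hK⟩ :=
    exists_isHolderCZKernel_newtonNearHess (r₀ := (1 / 2 : ℝ)) (r₁ := 1) (by norm_num) (by norm_num)
  obtain ⟨C₀, hC₀, hψ⟩ := exists_norm_fderiv_ballCutoff_le
  set c₃ : ℝ := 3 * (volume : Measure (EuclideanSpace ℝ (Fin 3))).real (ball 0 1) with hc₃
  have hc₃0 : 0 ≤ c₃ := three_mul_volume_real_ball_nonneg
  set C : ℝ := 162 * A * c₃ * (1 + Real.sqrt C₀) + 3 * lamGradL2 with hC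
  have hS0 : 0 ≤ Real.sqrt C₀ := Real.sqrt_nonneg _
  have hL0 : 0 ≤ lamGradL2 := lamGradL2_nonneg
  have hC0 : 0 ≤ C := by rw [hC]; positivity
  refine ⟨C, hC0, fun v hv hdiv hint H Ω hH hΩ δ hδ hδ1 x => ?_⟩
  have hψ1 : ∀ y, ‖fderiv ℝ (ballCutoff x 1) y‖ ≤ C₀ := fun y => by
    have := hψ x 1 one_pos y; rwa [div_one] at this
  have hlog0 : 0 ≤ Real.log (1 / δ) := Real.log_nonneg ((one_le_div hδ).2 hδ1)
  have hd0 : 0 ≤ δ ^ (1 / 2 : ℝ) := Real.rpow_nonneg hδ.le _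
  have hE0 : 0 ≤ Real.sqrt (∫ y, ‖v y‖ ^ 2) := Real.sqrt_nonneg _
  -- the local Biot–Savart law on the unit ball about `x`
  have hrep := opNorm_fderiv_le_hessMajorant_add (c := x) hv hdiv one_pos (mem_ball_self one_pos)
  have hfar := sum_abs_fderiv_smoothing_le_sqrt (c := x) hv one_pos hint x
  have hfar' : ∑ k, ∑ m,
      |fderiv ℝ (newtonFarSmoothing (1 / 2) 1 (locVel v x 1 m)) x (EuclideanSpace.single k (1 : ℝ))| ≤
      3 * lamGradL2 * Real.sqrt (∫ y, ‖v y‖ ^ 2) := by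
    have e : Real.sqrt ((1 : ℝ)⁻¹ ^ 5) = 1 := by norm_num
    rw [e, one_mul] at hfar
    simpa [mul_comm, mul_assoc, mul_left_comm] using hfar
  -- the 27 Hessian entries
  set bd : ℝ := A * c₃ *
    ((H + Ω * Real.sqrt C₀) * (δ ^ (1 / 2 : ℝ) / (1 / 2)) + 2 * Ω * Real.log (1 / δ)) with hbd
  have hentry : ∀ k a b : Fin 3, |hessPot v x 1 k a b x| ≤ bd := fun k a b =>
    abs_hessPot_le_log (c := x) hv hH hΩ hC₀ hψ1 hK hδ hδ1 k a b x
  have hmaj : hessMajorant v x 1 x ≤ 27 * bd := by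
    rw [hessMajorant]
    calc ∑ k, ∑ a, ∑ b, |hessPot v x 1 k a b x| ≤ ∑ _k : Fin 3, ∑ _a : Fin 3, ∑ _b : Fin 3, bd := by
          gcongr with k _ a _ b _
          exact hentry k a b
      _ = 27 * bd := by simp; ring
  -- assemble
  have hH0 : (0 : ℝ) ≤ H := H.coe_nonneg
  have hΩ0 : (0 : ℝ) ≤ Ω := Ω.coe_nonneg
  have hbd_le : 81 * bd ≤ 162 * A * c₃ * (1 + Real.sqrt C₀) *
      ((H + Ω) * δ ^ (1 / 2 : ℝ) + Ω * Real.log (1 / δ)) := by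
    rw [hbd]
    have h1 : (H : ℝ) + Ω * Real.sqrt C₀ ≤ (1 + Real.sqrt C₀) * (H + Ω) := by
      nlinarith [mul_nonneg hH0 hS0, mul_nonneg hΩ0 hS0]
    have h2 : A * c₃ * ((H + Ω * Real.sqrt C₀) * (δ ^ (1 / 2 : ℝ) / (1 / 2))) ≤
        2 * A * c₃ * (1 + Real.sqrt C₀) * ((H + Ω) * δ ^ (1 / 2 : ℝ)) := by
      have := mul_le_mul_of_nonneg_right h1 (mul_nonneg (mul_nonneg hA hc₃0) hd0)
      nlinarith [this]
    have h3 : A * c₃ * (2 * Ω * Real.log (1 / δ)) ≤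
        2 * A * c₃ * (1 + Real.sqrt C₀) * (Ω * Real.log (1 / δ)) := by
      have h4 : (1 : ℝ) ≤ 1 + Real.sqrt C₀ := by linarith
      have h5 : 0 ≤ 2 * A * c₃ * (Ω * Real.log (1 / δ)) := by positivity
      nlinarith [mul_le_mul_of_nonneg_left h4 h5]
    nlinarith [h2, h3]
  calc ‖fderiv ℝ v x‖ ≤ 3 * hessMajorant v x 1 x +
        ∑ k, ∑ m, |fderiv ℝ (newtonFarSmoothing (1 / 2) 1 (locVel v x 1 m)) x
          (EuclideanSpace.single k (1 : ℝ))| := hrep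
    _ ≤ 3 * (27 * bd) + 3 * lamGradL2 * Real.sqrt (∫ y, ‖v y‖ ^ 2) := by gcongr
    _ = 81 * bd + 3 * lamGradL2 * Real.sqrt (∫ y, ‖v y‖ ^ 2) := by ring
    _ ≤ 162 * A * c₃ * (1 + Real.sqrt C₀) * ((H + Ω) * δ ^ (1 / 2 : ℝ) + Ω * Real.log (1 / δ)) +
          3 * lamGradL2 * Real.sqrt (∫ y, ‖v y‖ ^ 2) := by gcongr
    _ ≤ C * ((H + Ω) * δ ^ (1 / 2 : ℝ) + Ω * Real.log (1 / δ)) +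
          C * Real.sqrt (∫ y, ‖v y‖ ^ 2) := by
        have hX0 : 0 ≤ (H + Ω) * δ ^ (1 / 2 : ℝ) + Ω * Real.log (1 / δ) := by positivity
        have i1 : 162 * A * c₃ * (1 + Real.sqrt C₀) ≤ C := by rw [hC]; nlinarith
        have i2 : 3 * lamGradL2 ≤ C := by rw [hC]; nlinarith [mul_nonneg (mul_nonneg hA hc₃0) hS0]
        gcongr
    _ = C * ((H + Ω) * δ ^ (1 / 2 : ℝ) + Ω * Real.log (1 / δ) + Real.sqrt (∫ y, ‖v y‖ ^ 2)) := by
        ring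

end Velocity

/-! ### The Hölder constant of the vorticity from Sobolev norms -/

section HolderSobolev

/-- **"`‖ω‖_γ ≤ c‖ω‖₂`" (Majda–Bertozzi, Sobolev inequality (3.30), p. 117) with `γ = ½`, in
scale-invariant form**: there is an absolute constant `C_H` such that for every `C³` field `v` on
`ℝ³` whose vorticity `ω = curl v` has `Dω ∈ L²` and `D²ω ∈ L²`, `ω` is `½`-Hölder with constant
`C_H ‖D²ω‖_{L²}`: Morrey's inequality `|ω(x) − ω(y)| ≤ C_M‖Dω‖_{L⁶}|x − y|^{1/2}`
(`FunctionSpaces.morrey_holder`, `p = 6 > 3`) and the Gagliardo–Nirenberg–Sobolev inequality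
`‖Dω‖_{L⁶} ≤ K‖D²ω‖_{L²}` (`eLpNorm_six_le_eLpNorm_fderiv_two`, legitimate as `Dω ∈ L²`). [cite: MajdaBertozzi2002, §3.3 proof of Prop. 3.8 (Sobolev inequality (3.30)) (p. 117)] -/
theorem exists_holderWith_curl :
    ∃ C_H : ℝ≥0, ∀ (v : (EuclideanSpace ℝ (Fin 3)) → (EuclideanSpace ℝ (Fin 3))), ContDiff ℝ 3 v →
      eLpNorm (fderiv ℝ (curl v)) 2 volume < ⊤ →
      eLpNorm (fderiv ℝ (fderiv ℝ (curl v))) 2 volume < ⊤ →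
      HolderWith (C_H * (eLpNorm (fderiv ℝ (fderiv ℝ (curl v))) 2 volume).toNNReal) (1 / 2)
        (curl v) := by
  obtain ⟨CM, hCM, hM⟩ := FunctionSpaces.morrey_holder (E := (EuclideanSpace ℝ (Fin 3))) (F := (EuclideanSpace ℝ (Fin 3)))
    (volume : Measure (EuclideanSpace ℝ (Fin 3))) (p := 6) (by norm_num) (by rw [finrank_euclideanSpace_fin]; norm_num)
  set K : ℝ≥0 := SNormLESNormFDerivOfEqConst ((EuclideanSpace ℝ (Fin 3)) →L[ℝ] (EuclideanSpace ℝ (Fin 3))) (volume : Measure (EuclideanSpace ℝ (Fin 3))) 2 with hK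
  refine ⟨CM.toNNReal * K, fun v hv h1 h2 => ?_⟩
  have hω2 : ContDiff ℝ 2 (curl v) := contDiff_curl (n := 2) hv
  have hω1 : ContDiff ℝ 1 (curl v) := hω2.of_le one_le_two
  have hDω1 : ContDiff ℝ 1 (fderiv ℝ (curl v)) := hω2.fderiv_right (m := 1) le_rfl
  -- Gagliardo–Nirenberg–Sobolev for `Dω`
  have hGNS : eLpNorm (fderiv ℝ (curl v)) 6 volume ≤
      K * eLpNorm (fderiv ℝ (fderiv ℝ (curl v))) 2 volume :=
    eLpNorm_six_le_eLpNorm_fderiv_two (volume : Measure (EuclideanSpace ℝ (Fin 3))) finrank_euclideanSpace_fin hDω1 h1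
  intro x y
  have hxy := hM hω1 x y
  have hexp : (1 : ℝ) - (Module.finrank ℝ (EuclideanSpace ℝ (Fin 3)) : ℝ) / ((6 : ℝ≥0) : ℝ) = ((1 / 2 : ℝ≥0) : ℝ) := by
    rw [finrank_euclideanSpace_fin]; norm_num
  rw [hexp] at hxy
  rw [edist_eq_enorm_sub]
  refine hxy.trans ?_
  have hS : eLpNorm (fderiv ℝ (fderiv ℝ (curl v))) 2 volume =
      ((eLpNorm (fderiv ℝ (fderiv ℝ (curl v))) 2 volume).toNNReal : ℝ≥0∞) :=
    (ENNReal.coe_toNNReal h2.ne).symm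
  have hCM' : (CM : ℝ≥0∞) = ((CM.toNNReal : ℝ≥0) : ℝ≥0∞) := (ENNReal.coe_toNNReal hCM.ne).symm
  calc CM * eLpNorm (fderiv ℝ (curl v)) 6 volume * edist x y ^ (((1 / 2 : ℝ≥0) : ℝ))
      ≤ CM * (K * eLpNorm (fderiv ℝ (fderiv ℝ (curl v))) 2 volume) *
          edist x y ^ (((1 / 2 : ℝ≥0) : ℝ)) := by gcongr
    _ = ((CM.toNNReal * K * (eLpNorm (fderiv ℝ (fderiv ℝ (curl v))) 2 volume).toNNReal : ℝ≥0) :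
          ℝ≥0∞) * edist x y ^ (((1 / 2 : ℝ≥0) : ℝ)) := by
        rw [ENNReal.coe_mul, ENNReal.coe_mul, ← hCM', ← hS]
        ring

end HolderSobolev

end Literature.Analysis.FluidPDE
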